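import Summits.BirchSwinnertonDyer.Rank1Residual.Additive.QuadraticTwistBSDComparison
import Summits.BirchSwinnertonDyer.Rank1Residual.Additive.GordCycLowerBound
import HarnessLib

/-!
# The twist-transport comparison statement — the RELATIONS-row schema in analytic rank `≤ 1` (cell `b2b-bsdres`, team n1011, route (c), item T-c1, complement)

HONEST FRAMING (cell `b2b-bsdres`, run/shared/lean/b2b/bsd-rank1-residual/, verbatim in every
file): the goal of the cell is to DELETE the COMBINATION-SHAPED residual classes of the
Birch–Swinnerton-Dyer formula for ALL analytic-rank `≤ 1` elliptic curves over `ℚ` — "full BSD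
formula for every rank `≤ 1` curve in class `C`" assembled STRICTLY from published theorems — so
that the rank-`≤ 1` remainder becomes exactly the CONSTRUCTION-SHAPED classes, which are TYPED
(missing-input `Prop`s), NOT attempted. This is not "finishing BSD". Team n1011 (N10 / N11; O7 =
the `r = 1` strand): prove what is provable now; shrink each hard class to its core with data; no
claim beyond stated classes; research routes; census output = EVIDENCE / conjecture items, never a
Literature fact.

Theorems only (no definition, no new named fact). Fourth file of item T-c1. Layer A
(`QuadraticTwistBSDComparison.lean`) unfolded the comparison statement `DefectAgreeAt W V p` into
RELATIONS-table columns in analytic rank `0` (`defectAgreeAt_iff_shaIndex_rankZero`). The O7 rows of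
the E3 table (CLASS-CLOSURE-PLAN §3.3; cc-eng-3 RELATIONS-v1: O7-ord 9 618 / 11 063 cells with a
closed twist partner) are rank-ONE pairs, where the rational analytic column is the print-shape
quotient `s_X := L^{(r)}(X,1)/(r!·Ω(X)·Reg(X))` (Yan–Zhu / JSW display; the tree's `PPart`
currency). This file gives the schema for ANY analytic ranks `≤ 1` on the two sides in that
currency (the rational `#Ш_an` being n1011-p18's `shaAn_eq_of_leadingLCoeff_eq`, `GordCycLowerBound.lean`):
with `L^{(r)}(W,1)/r! = s·Ω(W)·Reg(W)` and `L^{(r')}(V,1)/r'! = s'·Ω(V)·Reg(V)`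
(`s, s' ∈ ℚ`, nonzero by modularity),
`DefectAgreeAt W V p ⟺ ord_p #Ш(W) − ord_p #Ш(V) = (ord_p s − ord_p s') + 2(ord_p #W(ℚ)_tors − ord_p #V(ℚ)_tors) − (ord_p ∏c(W) − ord_p ∏c(V))`
(`defectAgreeAt_iff_shaIndex_of_leadingTerm`), hence `BSDp W p ↔ BSDp V p` GIVEN that identity
(`bsdp_iff_bsdp_of_leadingTerm_of_shaIndex`) and the one-sided readings. The rank-`0` theorems of
Layer A are the case `Reg = 1`. HONESTY as in Layer A/B: the `Ш`-column is the non-computable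
input; in rank `1` the column `s` is exact only through a Gross–Zagier index computation (lane
instrument P1), and a closed partner transports nothing by itself. Moves no mark; closes no pair.

References: Miller 2011 [Miller2011LMS] Def. 1.1; Yan–Zhu 2026 [YanZhu2026] Thm. 4.15 (display);
Jetchev–Skinner–Wan 2017 [JetchevSkinnerWan2017] Thm. 1.2.1 (display); Darmon 2004 [Darmon2004]
Thm. 3.22.
-/

noncomputable section

open scoped Classical

open WeierstrassCurve Literature.NumberTheory.EllipticCurves
  Literature.NumberTheory.EllipticCurves.Rank1Residual
  Literature.NumberTheory.EllipticCurves.Rank1Residual.Typed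

namespace Summit.BirchSwinnertonDyer.Rank1Residual.Additive

namespace TwistComparison

variable (W V : WeierstrassCurve ℚ) [W.IsElliptic] [V.IsElliptic] (p : ℕ) [Fact p.Prime]

omit V [V.IsElliptic] [Fact p.Prime] in
/-- `L^{(r)}(W,1)/r! = s · Ω(W) · Reg(W)` forces `s ≠ 0` (modularity `hmod`:
`leadingLCoeff_ne_zero_holds`). [cite: BirchSwinnertonDyer1965] -/
theorem ne_zero_of_leadingLCoeff_eq (hmod : hasEntireLFunction_rat) {s : ℚ}
    (hs : W.leadingLCoeff = (s : ℂ) * (W.realPeriodRat : ℂ) * (W.regulator : ℂ)) : s ≠ 0 := by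
  rintro rfl
  apply W.leadingLCoeff_ne_zero_holds (hmod W)
  rw [hs]
  simp

/-- **The comparison statement in RELATIONS-table columns, any analytic ranks (print-shape
currency).** With `L^{(r)}(W,1)/r! = s·Ω(W)·Reg(W)` and `L^{(r')}(V,1)/r'! = s'·Ω(V)·Reg(V)`
(`s, s' ∈ ℚ`, nonzero by `hmod`): `δ_p(W) = δ_p(V)` iff
`ord_p #Ш(W) − ord_p #Ш(V) = (ord_p s − ord_p s') + 2(ord_p #W(ℚ)_tors − ord_p #V(ℚ)_tors)
 − (ord_p ∏c(W) − ord_p ∏c(V))`. Layer A's rank-`0` schema is the case `Reg = 1`.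
[cite: Miller2011LMS, Def. 1.1] [cite: YanZhu2026, Thm. 4.15 (display)] -/
theorem defectAgreeAt_iff_shaIndex_of_leadingTerm (hmod : hasEntireLFunction_rat) {s s' : ℚ}
    (hs : W.leadingLCoeff = (s : ℂ) * (W.realPeriodRat : ℂ) * (W.regulator : ℂ))
    (hs' : V.leadingLCoeff = (s' : ℂ) * (V.realPeriodRat : ℂ) * (V.regulator : ℂ)) :
    DefectAgreeAt W V p ↔
      (padicValNat p W.shaOrder : ℤ) - (padicValNat p V.shaOrder : ℤ) =
        (padicValRat p s - padicValRat p s') +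
          2 * ((padicValNat p W.torsionOrder : ℤ) - (padicValNat p V.torsionOrder : ℤ)) -
          ((padicValNat p W.tamagawaProduct : ℤ) - (padicValNat p V.tamagawaProduct : ℤ)) := by
  rw [defectAgreeAt_iff_of_shaAn_eq W V p (shaAn_eq_of_leadingLCoeff_eq W hs)
      (shaAn_eq_of_leadingLCoeff_eq V hs'),
    padicValRat_shaAnRat_of_rankZero W p (ne_zero_of_leadingLCoeff_eq W hmod hs)
      W.torsionOrder_pos_holds W.tamagawaProduct_pos_holds,
    padicValRat_shaAnRat_of_rankZero V p (ne_zero_of_leadingLCoeff_eq V hmod hs')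
      V.torsionOrder_pos_holds V.tamagawaProduct_pos_holds]
  constructor <;> intro h <;> linarith

/-- **`BSDp W p ↔ BSDp V p` GIVEN the `Ш`-index identity, analytic ranks `≤ 1` on both sides (any
combination, e.g. the O7 rank-one rows against a rank-one or rank-zero closed partner).** Binders:
GZK `hGZK`, modularity `hmod`, the two print-shape presentations.
[cite: Miller2011LMS, Def. 1.1] [cite: Darmon2004, Thm. 3.22] -/
theorem bsdp_iff_bsdp_of_leadingTerm_of_shaIndex
    (hGZK : rank_eq_analyticRank_of_analyticRank_le_one) (hmod : hasEntireLFunction_rat)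
    (hrW : W.analyticRank ≤ 1) (hrV : V.analyticRank ≤ 1) {s s' : ℚ}
    (hs : W.leadingLCoeff = (s : ℂ) * (W.realPeriodRat : ℂ) * (W.regulator : ℂ))
    (hs' : V.leadingLCoeff = (s' : ℂ) * (V.realPeriodRat : ℂ) * (V.regulator : ℂ))
    (hidx : (padicValNat p W.shaOrder : ℤ) - (padicValNat p V.shaOrder : ℤ) =
        (padicValRat p s - padicValRat p s') +
          2 * ((padicValNat p W.torsionOrder : ℤ) - (padicValNat p V.torsionOrder : ℤ)) -
          ((padicValNat p W.tamagawaProduct : ℤ) - (padicValNat p V.tamagawaProduct : ℤ))) :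
    BSDp W p ↔ BSDp V p :=
  bsdp_iff_bsdp_of_defectAgreeAt W V p hGZK hrW hrV
    ((defectAgreeAt_iff_shaIndex_of_leadingTerm W V p hmod hs hs').mpr hidx)

/-- **Necessity in columns, ranks `≤ 1`**: two BSD-true pairs balance the row.
[cite: Miller2011LMS, Def. 1.1] -/
theorem shaIndex_of_bsdp_of_bsdp_of_leadingTerm
    (hGZK : rank_eq_analyticRank_of_analyticRank_le_one) (hmod : hasEntireLFunction_rat)
    (hrW : W.analyticRank ≤ 1) (hrV : V.analyticRank ≤ 1) {s s' : ℚ}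
    (hs : W.leadingLCoeff = (s : ℂ) * (W.realPeriodRat : ℂ) * (W.regulator : ℂ))
    (hs' : V.leadingLCoeff = (s' : ℂ) * (V.realPeriodRat : ℂ) * (V.regulator : ℂ))
    (hW : BSDp W p) (hV : BSDp V p) :
    (padicValNat p W.shaOrder : ℤ) - (padicValNat p V.shaOrder : ℤ) =
        (padicValRat p s - padicValRat p s') +
          2 * ((padicValNat p W.torsionOrder : ℤ) - (padicValNat p V.torsionOrder : ℤ)) -
          ((padicValNat p W.tamagawaProduct : ℤ) - (padicValNat p V.tamagawaProduct : ℤ)) := by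
  haveI : Finite W.sha := (hGZK W hrW).2
  haveI : Finite V.sha := (hGZK V hrV).2
  exact (defectAgreeAt_iff_shaIndex_of_leadingTerm W V p hmod hs hs').mp
    (defectAgreeAt_of_bsdp_of_bsdp W V p hW hV)

/-- **LOWER half of `W` from a CLOSED `V` and the `Ш`-index inequality, ranks `≤ 1`.**
[cite: Miller2011LMS, Def. 1.1] -/
theorem missingLowerBoundAt_of_bsdp_of_leadingTerm_of_shaIndex_ge
    (hGZK : rank_eq_analyticRank_of_analyticRank_le_one) (hmod : hasEntireLFunction_rat)
    (hrV : V.analyticRank ≤ 1) {s s' : ℚ}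
    (hs : W.leadingLCoeff = (s : ℂ) * (W.realPeriodRat : ℂ) * (W.regulator : ℂ))
    (hs' : V.leadingLCoeff = (s' : ℂ) * (V.realPeriodRat : ℂ) * (V.regulator : ℂ))
    (hV : BSDp V p)
    (hge : (padicValRat p s - padicValRat p s') +
          2 * ((padicValNat p W.torsionOrder : ℤ) - (padicValNat p V.torsionOrder : ℤ)) -
          ((padicValNat p W.tamagawaProduct : ℤ) - (padicValNat p V.tamagawaProduct : ℤ)) ≤
        (padicValNat p W.shaOrder : ℤ) - (padicValNat p V.shaOrder : ℤ)) :
    MissingLowerBoundAt W p := by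
  haveI : Finite V.sha := (hGZK V hrV).2
  refine missingLowerBoundAt_of_bsdp_of_defect_le W V p hV
    (shaAn_eq_of_leadingLCoeff_eq W hs) (shaAn_eq_of_leadingLCoeff_eq V hs') ?_
  rw [padicValRat_shaAnRat_of_rankZero W p (ne_zero_of_leadingLCoeff_eq W hmod hs)
      W.torsionOrder_pos_holds W.tamagawaProduct_pos_holds,
    padicValRat_shaAnRat_of_rankZero V p (ne_zero_of_leadingLCoeff_eq V hmod hs')
      V.torsionOrder_pos_holds V.tamagawaProduct_pos_holds]
  linarith

/-- **UPPER half of `W` from a CLOSED `V` and the reverse inequality, ranks `≤ 1`.**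
[cite: Miller2011LMS, Def. 1.1] -/
theorem missingUpperBoundAt_of_bsdp_of_leadingTerm_of_shaIndex_le
    (hGZK : rank_eq_analyticRank_of_analyticRank_le_one) (hmod : hasEntireLFunction_rat)
    (hrV : V.analyticRank ≤ 1) {s s' : ℚ}
    (hs : W.leadingLCoeff = (s : ℂ) * (W.realPeriodRat : ℂ) * (W.regulator : ℂ))
    (hs' : V.leadingLCoeff = (s' : ℂ) * (V.realPeriodRat : ℂ) * (V.regulator : ℂ))
    (hV : BSDp V p)
    (hle : (padicValNat p W.shaOrder : ℤ) - (padicValNat p V.shaOrder : ℤ) ≤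
        (padicValRat p s - padicValRat p s') +
          2 * ((padicValNat p W.torsionOrder : ℤ) - (padicValNat p V.torsionOrder : ℤ)) -
          ((padicValNat p W.tamagawaProduct : ℤ) - (padicValNat p V.tamagawaProduct : ℤ))) :
    MissingUpperBoundAt W p := by
  haveI : Finite V.sha := (hGZK V hrV).2
  refine missingUpperBoundAt_of_bsdp_of_defect_ge W V p hV
    (shaAn_eq_of_leadingLCoeff_eq W hs) (shaAn_eq_of_leadingLCoeff_eq V hs') ?_
  rw [padicValRat_shaAnRat_of_rankZero W p (ne_zero_of_leadingLCoeff_eq W hmod hs)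
      W.torsionOrder_pos_holds W.tamagawaProduct_pos_holds,
    padicValRat_shaAnRat_of_rankZero V p (ne_zero_of_leadingLCoeff_eq V hmod hs')
      V.torsionOrder_pos_holds V.tamagawaProduct_pos_holds]
  linarith

/-- The rank-`0` presentation `L(W,1) = s·Ω(W)` is a print-shape presentation with `Reg = 1`
(`rank = r_an = 0` by GZK); so the rank-`0` schema of Layer A is the special case of this file's.
[cite: Darmon2004, Thm. 3.22] -/
theorem leadingLCoeff_eq_of_rankZero_presentation
    (hGZK : rank_eq_analyticRank_of_analyticRank_le_one) (hr : W.analyticRank = 0) {s : ℚ}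
    (hs : W.entireLFunction 1 = (s : ℂ) * (W.realPeriodRat : ℂ)) :
    W.leadingLCoeff = (s : ℂ) * (W.realPeriodRat : ℂ) * (W.regulator : ℂ) := by
  have hrank : W.mordellWeilRank = 0 := by
    have := (hGZK W (by omega)).1
    omega
  rw [leadingLCoeff_eq_of_analyticRank_eq_zero W hr, hs, W.regulator_eq_one_of_rank_zero hrank]
  push_cast
  ring

end TwistComparison

end Summit.BirchSwinnertonDyer.Rank1Residual.Additive

end
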